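import Mathlib
import Literature.Computability.AlgebraicComplexity.GroupTheoreticMatMul
import Literature.Barriers.MatrixMultiplication.TricoloredSumFreeBarrier
import Summits.MatrixMultiplication.MatrixMultiplication.Theorems.AbelianSTPPCensusCrossPacking

/-!
# The two-member normal form: an STPP pair is two TPP triples whose difference sets avoid each other's room sets (cell mm-stpp, eng-2 g6)

Unrolling the tree's three-local normal form `STPPCrossPacking.isSTPP_iff_cross` at `N = 2`.  Write, for a triple `(A, B, C)`,
`D = A − B`, `E = B − C`, `F = C − A` and the three **room sets** (U14⁺ sets, one per letter world)
`X^D = (A − B) + (C − C)`, `X^E = (B − C) + (A − A)`, `X^F = (C − A) + (B − B)`.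
Then (`isSTPP_pair_iff`):

  `IsSTPP ![A₁, A₂] ![B₁, B₂] ![C₁, C₂]  ↔  (A₁,B₁,C₁) TPP ∧ (A₂,B₂,C₂) TPP ∧`
  `D₂ ∩ X^D₁ = ∅ ∧ E₂ ∩ X^E₁ = ∅ ∧ F₂ ∩ X^F₁ = ∅ ∧ D₁ ∩ X^D₂ = ∅ ∧ E₁ ∩ X^E₂ = ∅ ∧ F₁ ∩ X^F₂ = ∅`

— the six non-constant index patterns of CKSU Def. 5.1 for two members are exactly the six statements «a difference set of one member avoids a
room set of the other» (pattern `(2,1,1)`: `0 ∉ D₂ + E₁ + F₁ ⟺ D₂ ∩ −(E₁ + F₁) = ∅`, and `−(E₁ + F₁) = X^D₁`; the other five by the letter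
rotation and the member swap).  Consequences used by the cell: a member with LARGE rooms leaves little space for a partner's difference sets
(`|D₂| = |A₂||B₂| ≤ |H| − |X^D₁|`, cross packing), and an exact search for the partners of a fixed triple is a search for a TPP triple whose
three difference sets live in three prescribed sets (the complements of the fixed triple's rooms) and whose rooms avoid three prescribed
49-point sets — the encoding used by the cell's `partner.c` / `pq.c` (eng-2 g6, HOME/mm-stpp-eng-2/pair6/).

WHAT THIS IS NOT: no `ω` statement, no census row, no existence or non-existence claim; a reformulation (any abelian group, any block sizes).
-/

-- single-conjunct summit: the mandated namespace repeats `MatrixMultiplication`.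
set_option linter.dupNamespace false
set_option autoImplicit false

namespace Summit.MatrixMultiplication.MatrixMultiplication.Theorems

namespace STPPPairCriterion

open Finset Literature.Computability.AlgebraicComplexity
open scoped Pointwise

variable {H : Type*} [AddCommGroup H] [DecidableEq H] {A₁ B₁ C₁ A₂ B₂ C₂ : Finset H}

/-- **Forward direction, `D`-world:** in an STPP pair, member 2's difference set `A₂ − B₂` avoids member 1's room set `(A₁ − B₁) + (C₁ − C₁)`
(pattern `(2,1,1)`; `STPPCrossPacking.disjoint_sub_cross`). [cite: CohnKleinbergSzegedyUmans2005, Def. 5.1] -/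
theorem disjoint_D₂_roomD₁ (h : IsSTPP ![A₁, A₂] ![B₁, B₂] ![C₁, C₂]) :
    Disjoint (A₂ - B₂) ((A₁ - B₁) + (C₁ - C₁)) := by
  simpa using STPPCrossPacking.disjoint_sub_cross (t := 1) (j := 0) (k := 0) h (by decide)

/-- Forward direction, `D`-world, members swapped: `A₁ − B₁` avoids `(A₂ − B₂) + (C₂ − C₂)` (pattern `(1,2,2)`).
[cite: CohnKleinbergSzegedyUmans2005, Def. 5.1] -/
theorem disjoint_D₁_roomD₂ (h : IsSTPP ![A₁, A₂] ![B₁, B₂] ![C₁, C₂]) :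
    Disjoint (A₁ - B₁) ((A₂ - B₂) + (C₂ - C₂)) := by
  simpa using STPPCrossPacking.disjoint_sub_cross (t := 0) (j := 1) (k := 1) h (by decide)

/-- Forward direction, `E`-world: `B₂ − C₂` avoids `(B₁ − C₁) + (A₁ − A₁)` (pattern `(1,2,1)`, i.e. the `D`-world statement for the rotated
family `(B, C, A)`). [cite: CohnKleinbergSzegedyUmans2005, Def. 5.1] -/
theorem disjoint_E₂_roomE₁ (h : IsSTPP ![A₁, A₂] ![B₁, B₂] ![C₁, C₂]) :
    Disjoint (B₂ - C₂) ((B₁ - C₁) + (A₁ - A₁)) := by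
  have h' : IsSTPP ![B₁, B₂] ![C₁, C₂] ![A₁, A₂] := h.rotate
  simpa using STPPCrossPacking.disjoint_sub_cross (t := 1) (j := 0) (k := 0) h' (by decide)

/-- Forward direction, `E`-world, members swapped. [cite: CohnKleinbergSzegedyUmans2005, Def. 5.1] -/
theorem disjoint_E₁_roomE₂ (h : IsSTPP ![A₁, A₂] ![B₁, B₂] ![C₁, C₂]) :
    Disjoint (B₁ - C₁) ((B₂ - C₂) + (A₂ - A₂)) := by
  have h' : IsSTPP ![B₁, B₂] ![C₁, C₂] ![A₁, A₂] := h.rotate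
  simpa using STPPCrossPacking.disjoint_sub_cross (t := 0) (j := 1) (k := 1) h' (by decide)

/-- Forward direction, `F`-world: `C₂ − A₂` avoids `(C₁ − A₁) + (B₁ − B₁)` (pattern `(1,1,2)`, the `D`-world statement for `(C, A, B)`).
[cite: CohnKleinbergSzegedyUmans2005, Def. 5.1] -/
theorem disjoint_F₂_roomF₁ (h : IsSTPP ![A₁, A₂] ![B₁, B₂] ![C₁, C₂]) :
    Disjoint (C₂ - A₂) ((C₁ - A₁) + (B₁ - B₁)) := by
  have h' : IsSTPP ![C₁, C₂] ![A₁, A₂] ![B₁, B₂] := h.rotate.rotate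
  simpa using STPPCrossPacking.disjoint_sub_cross (t := 1) (j := 0) (k := 0) h' (by decide)

/-- Forward direction, `F`-world, members swapped. [cite: CohnKleinbergSzegedyUmans2005, Def. 5.1] -/
theorem disjoint_F₁_roomF₂ (h : IsSTPP ![A₁, A₂] ![B₁, B₂] ![C₁, C₂]) :
    Disjoint (C₁ - A₁) ((C₂ - A₂) + (B₂ - B₂)) := by
  have h' : IsSTPP ![C₁, C₂] ![A₁, A₂] ![B₁, B₂] := h.rotate.rotate
  simpa using STPPCrossPacking.disjoint_sub_cross (t := 0) (j := 1) (k := 1) h' (by decide)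

/-- The zero-sum form of one avoidance condition: if `X − Y` avoids `(X' − Y') + (Z' − Z)` then no `d ∈ X − Y`, `e ∈ Y' − Z'`, `f ∈ Z − X'` have
`d + e + f = 0` — stated for the `D`-world letters; `(d, e, f) = (a₂ − b₂, b₁ − c₁, c₁' − a₁)` regroups as `a₂ − b₂ = (a₁ − b₁) + (c₁ − c₁')`.
[bookkeeping] -/
theorem zero_not_mem_of_disjoint {X Y X' Y' Z Z' : Finset H} (h : Disjoint (X - Y) ((X' - Y') + (Z' - Z))) :
    (0 : H) ∉ (X - Y) + (Y' - Z') + (Z - X') := by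
  intro h0
  rw [mem_add] at h0
  obtain ⟨de, hde, f, hf, hdef⟩ := h0
  rw [mem_add] at hde
  obtain ⟨d, hd, e, he, rfl⟩ := hde
  rw [mem_sub] at he hf
  obtain ⟨y', hy', z', hz', rfl⟩ := he
  obtain ⟨z, hz, x', hx', rfl⟩ := hf
  have hd' : d ∈ (X' - Y') + (Z' - Z) := by
    rw [mem_add]
    refine ⟨x' - y', sub_mem_sub hx' hy', z' - z, sub_mem_sub hz' hz, ?_⟩
    have : d = -((y' - z') + (z - x')) := by
      rw [eq_neg_iff_add_eq_zero, ← hdef, add_assoc]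
    rw [this]; abel
  exact disjoint_left.1 h hd hd'

/-- **Two-member normal form of the STPP.**  A two-member family is `IsSTPP` iff both members are TPP triples (one-member families) and the six
avoidance conditions hold: the difference sets `D₂ = A₂ − B₂`, `E₂ = B₂ − C₂`, `F₂ = C₂ − A₂` of member 2 avoid the room sets
`X^D₁ = (A₁ − B₁) + (C₁ − C₁)`, `X^E₁ = (B₁ − C₁) + (A₁ − A₁)`, `X^F₁ = (C₁ − A₁) + (B₁ − B₁)` of member 1, and symmetrically with the members
exchanged.  (`N = 2` unrolling of `STPPCrossPacking.isSTPP_iff_cross`.) [original] -/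
theorem isSTPP_pair_iff :
    IsSTPP ![A₁, A₂] ![B₁, B₂] ![C₁, C₂] ↔
      IsSTPP ![A₁] ![B₁] ![C₁] ∧ IsSTPP ![A₂] ![B₂] ![C₂] ∧
      Disjoint (A₂ - B₂) ((A₁ - B₁) + (C₁ - C₁)) ∧ Disjoint (B₂ - C₂) ((B₁ - C₁) + (A₁ - A₁)) ∧ Disjoint (C₂ - A₂) ((C₁ - A₁) + (B₁ - B₁)) ∧
      Disjoint (A₁ - B₁) ((A₂ - B₂) + (C₂ - C₂)) ∧ Disjoint (B₁ - C₁) ((B₂ - C₂) + (A₂ - A₂)) ∧ Disjoint (C₁ - A₁) ((C₂ - A₂) + (B₂ - B₂)) := by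
  constructor
  · intro h
    refine ⟨?_, ?_, disjoint_D₂_roomD₁ h, disjoint_E₂_roomE₁ h, disjoint_F₂_roomF₁ h, disjoint_D₁_roomD₂ h, disjoint_E₁_roomE₂ h,
      disjoint_F₁_roomF₂ h⟩
    · simpa using STPPCrossPacking.isSTPP_single h 0
    · simpa using STPPCrossPacking.isSTPP_single h 1
  · rintro ⟨h1, h2, hD21, hE21, hF21, hD12, hE12, hF12⟩
    rw [STPPCrossPacking.isSTPP_iff_cross]
    refine ⟨fun i => ?_, fun i j k hne => ?_⟩
    · fin_cases i
      · simpa using h1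
      · simpa using h2
    · -- the six non-constant patterns; `D_i + E_j + F_k` with `D = A − B`, `E = B − C`, `F = C − A`
      -- the zero-sum forms of the six hypotheses (letters rotated so that the avoided set is written as `(X'−Y') + (Z'−Z)`):
      have zD21 := zero_not_mem_of_disjoint hD21  -- 0 ∉ (A₂−B₂) + (B₁−C₁) + (C₁−A₁)      : pattern (2,1,1) as (i,j,k) = (1,0,0)
      have zD12 := zero_not_mem_of_disjoint hD12  -- 0 ∉ (A₁−B₁) + (B₂−C₂) + (C₂−A₂)      : pattern (0,1,1)
      have zE21 := zero_not_mem_of_disjoint hE21  -- 0 ∉ (B₂−C₂) + (C₁−A₁) + (A₁−B₁)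
      have zE12 := zero_not_mem_of_disjoint hE12  -- 0 ∉ (B₁−C₁) + (C₂−A₂) + (A₂−B₂)
      have zF21 := zero_not_mem_of_disjoint hF21  -- 0 ∉ (C₂−A₂) + (A₁−B₁) + (B₁−C₁)
      have zF12 := zero_not_mem_of_disjoint hF12  -- 0 ∉ (C₁−A₁) + (A₂−B₂) + (B₂−C₂)
      -- rotate the three-term sums into the `D + E + F` order
      have rot : ∀ (P Q S : Finset H), (0 : H) ∉ P + Q + S → (0 : H) ∉ Q + S + P := by
        intro P Q S hP h0
        apply hP
        rw [mem_add] at h0 ⊢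
        obtain ⟨qs, hqs, p, hp, hsum⟩ := h0
        rw [mem_add] at hqs
        obtain ⟨q, hq, s, hs, rfl⟩ := hqs
        exact ⟨p + q, add_mem_add hp hq, s, hs, by rw [← hsum]; abel⟩
      fin_cases i <;> fin_cases j <;> fin_cases k
      · exact absurd ⟨rfl, rfl⟩ hne
      · -- (0,0,1): D₁ + E₁ + F₂ — from zF21 : 0 ∉ F₂ + D₁ + E₁
        simpa using rot _ _ _ zF21
      · -- (0,1,0): D₁ + E₂ + F₁ — from zE21 : 0 ∉ E₂ + F₁ + D₁, rotate twice
        simpa using rot _ _ _ (rot _ _ _ zE21)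
      · -- (0,1,1): D₁ + E₂ + F₂ — zD12 directly
        simpa using zD12
      · -- (1,0,0): D₂ + E₁ + F₁ — zD21 directly
        simpa using zD21
      · -- (1,0,1): D₂ + E₁ + F₂ — from zE12 : 0 ∉ E₁ + F₂ + D₂, rotate twice
        simpa using rot _ _ _ (rot _ _ _ zE12)
      · -- (1,1,0): D₂ + E₂ + F₁ — from zF12 : 0 ∉ F₁ + D₂ + E₂, rotate once
        simpa using rot _ _ _ zF12
      · exact absurd ⟨rfl, rfl⟩ hne

variable [Fintype H]

/-- **A partner's difference set fits in the complement of the other member's room** (cross packing, two-member form): in an STPP pair with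
`C₂ ≠ ∅`, `|A₂||B₂| + |(A₁ − B₁) + (C₁ − C₁)| ≤ |H|`. [original] -/
theorem card_mul_add_room_le (h : IsSTPP ![A₁, A₂] ![B₁, B₂] ![C₁, C₂]) (hC₂ : C₂.Nonempty) :
    A₂.card * B₂.card + ((A₁ - B₁) + (C₁ - C₁)).card ≤ Fintype.card H := by
  have hcard : (A₂ - B₂).card = A₂.card * B₂.card := by
    simpa using STPPPackingSumset.card_sub_eq h 1 (by simpa using hC₂)
  rw [← hcard, ← card_union_of_disjoint (disjoint_D₂_roomD₁ h)]
  exact card_le_univ _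

end STPPPairCriterion

end Summit.MatrixMultiplication.MatrixMultiplication.Theorems
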